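import Literature.MathematicalPhysics.QuantumFieldTheory.OSTimeContinuation
import Literature.Analysis.Distribution.SchwartzBoundaryFlatness
import HarnessLib

/-!
# The Euclidean integrand of an OS time continuation is integrable

`Literature.MathematicalPhysics.QuantumFieldTheory.OSTimeContinuation` records OS II, Thm. 4.3 as
the named fact `OS1975_exists_timeContinuation`: a function `𝔚ᴱ` continuous on the time tube,
holomorphic in the times, of **OS growth** (`HasOSGrowth`, the temperedness estimate (4.6) of
Osterwalder–Schrader II (1975): `‖𝔚ᴱ z‖ ≤ C (1 + ‖z‖)ᴺ (1 + ∑ₖ (Im (z⁰_k − z⁰_{k-1}))⁻¹)ᴺ`), whose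
Euclidean restriction gives the Schwinger function as the **Bochner integral**
`𝔖ₙ(F) = ∫ 𝔚ᴱ(ι x) F(x) dx` over time-ordered test functions `F`. The estimate (4.6) blows up
polynomially in the inverse time gaps, i.e. at the boundary of the time-ordered region
`Ω_< = {0 < x₀⁰ < ⋯ < x_{n-1}⁰}`, which is NOT locally integrable in general; the integral is
nevertheless an honest Lebesgue integral because a Schwartz function supported in `Ω_<` vanishes to
infinite order at `∂Ω_<`, quantitatively
(`SchwartzMap.exists_one_add_pow_mul_norm_le_infDist_pow`, `SchwartzBoundaryFlatness`). This file
proves the resulting integrability statement, used whenever the Euclidean restriction clause is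
manipulated (dominated convergence, Fubini, smearing):

* `norm_euclideanPoint_le` — `‖ι x‖ ≤ ‖x‖`;
* `infDist_compl_timeOrderedRegion_le_succDiff` — every time gap of `x ∈ Ω_<` (and `x₀⁰`) is at
  least `dist(x, Ω_<ᶜ)` (collapse the gap: `notMem_timeOrderedRegion_of_collapse`);
* `HasOSGrowth.norm_apply_euclideanPoint_le` — on `Ω_<`,
  `‖𝔚ᴱ(ι x)‖ ≤ C' (1 + ‖x‖)ᴺ (1 + dist(x, Ω_<ᶜ)⁻¹)ᴺ`;
* `HasOSGrowth.integrable_euclideanPoint_mul` — **for `𝔚ᴱ` continuous on the time tube with OS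
  growth and `F` time-ordered, `x ↦ 𝔚ᴱ(ι x) F(x)` is integrable**
  (`SchwartzMap.integrable_mul_of_norm_le_infDist_inv_pow`, after `1 + r⁻¹ ≤ r⁻¹ (1 + ‖x‖)` for
  `r = dist(x, Ω_<ᶜ) ≤ ‖x‖`, the zero configuration lying outside `Ω_<`).

## References

* K. Osterwalder, R. Schrader, *Axioms for Euclidean Green's functions II*, Comm. Math. Phys. 42
  (1975) 281–305, §IV.2, Thm. 4.2 eq. (4.6), Thm. 4.3, eq. (4.4). [OsterwalderSchraderCMP1975]
-/

noncomputable section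

open MeasureTheory Filter Set Metric Complex
open scoped SchwartzMap
open Literature.MathematicalPhysics.QuantumLattice Literature.Analysis.Distribution

namespace Literature.MathematicalPhysics.QuantumFieldTheory

variable {d n : ℕ}

/-! ### Norms and gaps at Euclidean points -/

/-- `‖ι x‖ ≤ ‖x‖`: the components of the Euclidean point `(i x⁰_k, x⃗_k)_k` are, in modulus, the
coordinates of `x` (sup norms outside, Euclidean norm on each `x_k`). [folklore] -/
theorem norm_euclideanPoint_le (x : Fin n → EuclideanSpace ℝ (Fin (d + 1))) :
    ‖euclideanPoint x‖ ≤ ‖x‖ := by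
  refine (pi_norm_le_iff_of_nonneg (norm_nonneg x)).2 fun k => ?_
  refine (pi_norm_le_iff_of_nonneg (norm_nonneg x)).2 fun μ => ?_
  have hk : ‖x k‖ ≤ ‖x‖ := norm_le_pi_norm x k
  refine le_trans ?_ hk
  refine Fin.cases ?_ (fun i => ?_) μ
  · rw [euclideanPoint_apply_zero, norm_mul, Complex.norm_I, one_mul, Complex.norm_real]
    exact PiLp.norm_apply_le (x k) 0
  · rw [euclideanPoint_apply_succ, Complex.norm_real]
    exact PiLp.norm_apply_le (x k) i.succ

/-- The imaginary parts of the successive time differences of a Euclidean point are the Euclidean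
time gaps. [folklore] -/
theorem im_succDiff_euclideanPoint (x : Fin n → EuclideanSpace ℝ (Fin (d + 1))) (k : Fin n) :
    (succDiff (fun j => euclideanPoint x j 0) k).im = succDiff (fun j => x j 0) k := by
  have h : (fun j => euclideanPoint x j 0) = fun j => (fun t : ℝ => I * (t : ℂ)) (x j 0) :=
    funext fun j => by simp
  rw [h, succDiff_map (fun t : ℝ => I * (t : ℂ)) (fun a b => by push_cast; ring)]
  simp

/-- The successive time differences of a time-ordered configuration are positive. [folklore] -/
theorem succDiff_pos_of_mem_timeOrderedRegion {x : Fin n → EuclideanSpace ℝ (Fin (d + 1))}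
    (hx : x ∈ timeOrderedRegion d n) (k : Fin n) : 0 < succDiff (fun j => x j 0) k := by
  cases n with
  | zero => exact k.elim0
  | succ m =>
    cases k using Fin.cases with
    | zero => rw [succDiff_zero]; exact hx.1 0
    | succ j => rw [succDiff_succ]; exact sub_pos.2 (hx.2 (Fin.castSucc_lt_succ (i := j)))

/-- Lowering the time of `x_k` onto the previous time (onto `0` for `k = 0`) and keeping everything
else produces a configuration outside the time-ordered region. [folklore] -/
theorem notMem_timeOrderedRegion_of_collapse {x y : Fin n → EuclideanSpace ℝ (Fin (d + 1))}
    (k : Fin n) (hyk : y k 0 = x k 0 - succDiff (fun j => x j 0) k)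
    (hyne : ∀ i, i ≠ k → y i = x i) : y ∉ timeOrderedRegion d n := by
  intro hyU
  cases n with
  | zero => exact k.elim0
  | succ m =>
    cases k using Fin.cases with
    | zero =>
      have h0 : 0 < y 0 0 := hyU.1 0
      have hyk' : y 0 0 = 0 := by rw [hyk, succDiff_zero]; ring
      rw [hyk'] at h0
      exact lt_irrefl _ h0
    | succ j =>
      have hlt : y (Fin.castSucc j) 0 < y j.succ 0 := hyU.2 (Fin.castSucc_lt_succ (i := j))
      have hne : Fin.castSucc j ≠ j.succ := (Fin.castSucc_lt_succ (i := j)).ne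
      have hyk' : y j.succ 0 = x (Fin.castSucc j) 0 := by
        rw [hyk, succDiff_succ]; ring
      rw [hyne _ hne, hyk'] at hlt
      exact lt_irrefl _ hlt

/-- **Collapsing a gap leaves the time-ordered region**: for `x ∈ Ω_<` and every `k`, the
configuration obtained by lowering the time of `x_k` onto the previous time (onto `0` for `k = 0`)
lies outside `Ω_<` at distance the `k`-th gap; hence `dist(x, Ω_<ᶜ) ≤ x⁰_k − x⁰_{k-1}`. [folklore] -/
theorem infDist_compl_timeOrderedRegion_le_succDiff {x : Fin n → EuclideanSpace ℝ (Fin (d + 1))}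
    (hx : x ∈ timeOrderedRegion d n) (k : Fin n) :
    infDist x (timeOrderedRegion d n)ᶜ ≤ succDiff (fun j => x j 0) k := by
  classical
  set g : ℝ := succDiff (fun j => x j 0) k with hg
  have hg0 : 0 < g := succDiff_pos_of_mem_timeOrderedRegion hx k
  set v : EuclideanSpace ℝ (Fin (d + 1)) := g • EuclideanSpace.single 0 1 with hv
  set y : Fin n → EuclideanSpace ℝ (Fin (d + 1)) := x - Pi.single k v with hy
  have hyk0 : y k 0 = x k 0 - g := by
    simp [hy, hv]
  have hyne : ∀ i, i ≠ k → y i = x i := fun i hi => by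
    simp [hy, Pi.single_eq_of_ne hi]
  have hyU : y ∈ (timeOrderedRegion d n)ᶜ := notMem_timeOrderedRegion_of_collapse k hyk0 hyne
  have hdist : dist x y = g := by
    rw [dist_eq_norm, hy, sub_sub_cancel, Pi.norm_single, hv, norm_smul, PiLp.norm_single,
      norm_one, mul_one, Real.norm_of_nonneg hg0.le]
  exact (infDist_le_dist_of_mem hyU).trans hdist.le

/-! ### OS growth at Euclidean points -/

/-- **OS growth at Euclidean points, in terms of the distance to the boundary of `Ω_<`**: if `𝔚`
has OS growth then for `x ∈ Ω_<`,
`‖𝔚(ι x)‖ ≤ max C 0 · (1 + n)ᴺ (1 + ‖x‖)ᴺ (1 + dist(x, Ω_<ᶜ)⁻¹)ᴺ` (each inverse gap is at most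
`dist(x, Ω_<ᶜ)⁻¹`, `infDist_compl_timeOrderedRegion_le_succDiff`). [cite: OsterwalderSchraderCMP1975, §IV.2 Thm. 4.2 eq. (4.6)] -/
theorem HasOSGrowth.norm_apply_euclideanPoint_le {𝔚 : (Fin n → Fin (d + 1) → ℂ) → ℂ}
    (h : HasOSGrowth 𝔚) :
    ∃ (C : ℝ) (N : ℕ), 0 ≤ C ∧ ∀ x ∈ timeOrderedRegion d n,
      ‖𝔚 (euclideanPoint x)‖ ≤
        C * (1 + ‖x‖) ^ N * (1 + (infDist x (timeOrderedRegion d n)ᶜ)⁻¹) ^ N := by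
  obtain ⟨C, N, hC⟩ := h
  refine ⟨max C 0 * (1 + n) ^ N, N, by positivity, fun x hx => ?_⟩
  set r : ℝ := infDist x (timeOrderedRegion d n)ᶜ with hr
  have hz := hC (euclideanPoint x) (euclideanPoint_mem_timeTube hx)
  simp only [im_succDiff_euclideanPoint] at hz
  -- the gaps dominate `r`
  have hgap : ∀ k, r ≤ succDiff (fun j => x j 0) k := fun k =>
    infDist_compl_timeOrderedRegion_le_succDiff hx k
  have hr0 : 0 ≤ r := infDist_nonneg
  have hsum : ∑ k, (succDiff (fun j => x j 0) k)⁻¹ ≤ n * r⁻¹ := by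
    by_cases hrpos : 0 < r
    · calc ∑ k, (succDiff (fun j => x j 0) k)⁻¹ ≤ ∑ _k : Fin n, r⁻¹ :=
            Finset.sum_le_sum fun k _ => inv_anti₀ hrpos (hgap k)
        _ = n * r⁻¹ := by simp
    · -- `r = 0`: then `n = 0` (for `n ≥ 1` the zero configuration is outside `Ω_<`), so both
      -- sides vanish; argue directly: every gap is positive, so `r = 0 < gap` is impossible
      -- unless there are no gaps.
      have hr00 : r = 0 := le_antisymm (not_lt.1 hrpos) hr0
      cases n with
      | zero => simp
      | succ m =>
        exfalso
        have hne : ((timeOrderedRegion d (m + 1))ᶜ).Nonempty :=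
          ⟨0, fun h0 => lt_irrefl (0 : ℝ) (by simpa using h0.1 0)⟩
        have hpos : 0 < r :=
          (isOpen_timeOrderedRegion.isClosed_compl.notMem_iff_infDist_pos hne).1
            (fun hc => hc hx)
        exact hrpos hpos
  have h1 : 1 + ∑ k, (succDiff (fun j => x j 0) k)⁻¹ ≤ (1 + n) * (1 + r⁻¹) := by
    have hri : 0 ≤ r⁻¹ := inv_nonneg.2 hr0
    have hn0 : (0 : ℝ) ≤ n := Nat.cast_nonneg _
    nlinarith [hsum, mul_nonneg hn0 hri]
  have h2 : (1 + ‖euclideanPoint x‖) ^ N ≤ (1 + ‖x‖) ^ N :=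
    pow_le_pow_left₀ (by positivity) (by linarith [norm_euclideanPoint_le x]) N
  have hS0 : 0 ≤ 1 + ∑ k, (succDiff (fun j => x j 0) k)⁻¹ := by
    refine add_nonneg zero_le_one (Finset.sum_nonneg fun k _ => inv_nonneg.2 ?_)
    exact hr0.trans (hgap k)
  set A : ℝ := 1 + ∑ k, (succDiff (fun j => x j 0) k)⁻¹ with hA
  have hC0 : 0 ≤ max C 0 := le_max_right _ _
  calc ‖𝔚 (euclideanPoint x)‖
      ≤ C * (1 + ‖euclideanPoint x‖) ^ N * A ^ N := hz
    _ ≤ max C 0 * (1 + ‖euclideanPoint x‖) ^ N * A ^ N :=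
        mul_le_mul_of_nonneg_right
          (mul_le_mul_of_nonneg_right (le_max_left _ _) (by positivity)) (pow_nonneg hS0 N)
    _ ≤ max C 0 * (1 + ‖x‖) ^ N * ((1 + n) * (1 + r⁻¹)) ^ N :=
        mul_le_mul (mul_le_mul_of_nonneg_left h2 hC0) (pow_le_pow_left₀ hS0 h1 N)
          (pow_nonneg hS0 N) (by positivity)
    _ = max C 0 * (1 + n) ^ N * (1 + ‖x‖) ^ N * (1 + r⁻¹) ^ N := by
        rw [mul_pow]; ring

/-! ### Integrability of the Euclidean integrand -/

/-- **The Euclidean integrand is integrable.** If `𝔚` is continuous on the time tube and has OS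
growth, then for every time-ordered test function `F` the function `x ↦ 𝔚(ι x) F(x)` is
integrable on `(ℝ^{d+1})ⁿ` — so that the Euclidean restriction clause
`𝔖ₙ(F) = ∫ 𝔚(ι x) F(x) dx` of `OS1975_exists_timeContinuation` (OS II (4.4)) is a genuine Lebesgue
integral. Proof: `HasOSGrowth.norm_apply_euclideanPoint_le` and the flatness of `F` at `∂Ω_<`
(`SchwartzMap.integrable_mul_of_norm_le_infDist_inv_pow`, with `1 + r⁻¹ ≤ r⁻¹ (1 + ‖x‖)` as
`r = dist(x, Ω_<ᶜ) ≤ ‖x‖`); `n = 0` is a one-point space. [cite: OsterwalderSchraderCMP1975, §IV.2 Thm. 4.3 eq. (4.4)] -/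
theorem HasOSGrowth.integrable_euclideanPoint_mul {𝔚 : (Fin n → Fin (d + 1) → ℂ) → ℂ}
    (hcont : ContinuousOn 𝔚 (timeTube d n)) (h : HasOSGrowth 𝔚)
    (F : 𝓢((Fin n → EuclideanSpace ℝ (Fin (d + 1))), ℂ)) (hF : IsTimeOrdered F) :
    Integrable fun x : Fin n → EuclideanSpace ℝ (Fin (d + 1)) => 𝔚 (euclideanPoint x) * F x := by
  cases n with
  | zero =>
    -- a one-point space of total mass one
    have hvol : (volume : Measure (Fin 0 → EuclideanSpace ℝ (Fin (d + 1)))) Set.univ = 1 := by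
      rw [volume_pi, ← Set.pi_univ, Measure.pi_pi]; simp
    haveI : IsFiniteMeasure (volume : Measure (Fin 0 → EuclideanSpace ℝ (Fin (d + 1)))) :=
      ⟨by rw [hvol]; exact ENNReal.one_lt_top⟩
    have hconst : (fun x : Fin 0 → EuclideanSpace ℝ (Fin (d + 1)) => 𝔚 (euclideanPoint x) * F x)
        = fun _ => 𝔚 (euclideanPoint default) * F default :=
      funext fun x => by rw [Subsingleton.elim x default]
    rw [hconst]
    exact integrable_const _
  | succ m =>
    have hU : IsOpen (timeOrderedRegion d (m + 1)) := isOpen_timeOrderedRegion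
    have hne : ((timeOrderedRegion d (m + 1))ᶜ).Nonempty :=
      ⟨0, fun h0 => lt_irrefl (0 : ℝ) (by simpa using h0.1 0)⟩
    have hg : ContinuousOn (fun x => 𝔚 (euclideanPoint x)) (timeOrderedRegion d (m + 1)) :=
      hcont.comp continuous_euclideanPoint.continuousOn fun x hx => euclideanPoint_mem_timeTube hx
    obtain ⟨C, N, hC0, hC⟩ := h.norm_apply_euclideanPoint_le
    -- pure inverse-power form: `1 + r⁻¹ = r⁻¹ (1 + r)` and `r ≤ dist(x, 0) = ‖x‖` (`0 ∉ Ω_<`)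
    have h0U : (0 : Fin (m + 1) → EuclideanSpace ℝ (Fin (d + 1))) ∈ (timeOrderedRegion d (m + 1))ᶜ :=
      fun h0 => lt_irrefl (0 : ℝ) (by simpa using h0.1 0)
    refine F.integrable_mul_of_norm_le_infDist_inv_pow volume hU hne hg (C := C) (N := N + N)
      (M := N) (fun x hxU => ?_) hF
    set r : ℝ := infDist x (timeOrderedRegion d (m + 1))ᶜ with hr
    have hrpos : 0 < r :=
      (hU.isClosed_compl.notMem_iff_infDist_pos hne).1 (fun hc => hc hxU)
    have hrx : r ≤ ‖x‖ := by
      calc r ≤ dist x 0 := infDist_le_dist_of_mem h0U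
        _ = ‖x‖ := dist_zero_right x
    have hinv : 1 + r⁻¹ ≤ r⁻¹ * (1 + ‖x‖) := by
      rw [show 1 + r⁻¹ = r⁻¹ * (1 + r) by field_simp; ring]
      gcongr
    calc ‖𝔚 (euclideanPoint x)‖ ≤ C * (1 + ‖x‖) ^ N * (1 + r⁻¹) ^ N := hC x hxU
      _ ≤ C * (1 + ‖x‖) ^ N * (r⁻¹ * (1 + ‖x‖)) ^ N := by
          gcongr
      _ = C * (1 + ‖x‖) ^ (N + N) * r⁻¹ ^ N := by rw [mul_pow, pow_add]; ring

end Literature.MathematicalPhysics.QuantumFieldTheory
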